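import Summits.ResolutionOfSingularities.ResolutionOfSingularities.Theorems.FrobeniusLadderFInjectiveMacaulayficationRetractRegular
import Mathlib.RingTheory.Localization.AtPrime.Basic
import Mathlib.RingTheory.Regular.RegularSequence
import Mathlib.RingTheory.KrullDimension.Basic
import Mathlib.Algebra.Polynomial.Div
import Mathlib.RingTheory.Polynomial.Basic
import Mathlib.RingTheory.LocalRing.RingHom.Basic
import HarnessLib

/-!
# Laurent descent of the clause along `A → A[X]` at `X = 1` (crux `FInjectiveMacaulayfication`, line `Sketch`, §16 H-G3)

Support file for crux stmt-ResolutionOfSingularities-15315 (`FrobeniusLadder.FInjectiveMacaulayfication`), §16 THE GRADED ENGINE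
(CRUX-PLAN w45a v2, line `graded-engine`; lead seat res-L1-w45a-lead-1; design memo GRADED-ENGINE.md v2, step (v)). In the graded
engine the chart ring `C = T'₀` of a weighted blow-up sits inside the Veronese subring `A' = T'₀[u, u⁻¹]` of the extended Rees algebra, and
the clause (every system of parameters weakly regular, every parameter ideal Frobenius closed) is obtained for `A'` by finite graded
descent; this file brings it DOWN from `A'` to `T'₀`. Abstractly: for a commutative ring `A` of characteristic `p`, a maximal ideal `𝔫`
and the prime `𝔑 = 𝔫·A[X] + (X − 1)` of `A[X]` (so `A[X]_𝔑 = A[X, X⁻¹]_{(𝔫, X−1)}`), if `A[X]_𝔑` satisfies the clause and has dimension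
`dim A_𝔫 + 1`, then `A_𝔫` satisfies the clause.

Proof (`laurentDescent`): evaluation at `X = 1` is a ring retraction `r : A[X] → A` with `r⁻¹(𝔫) = 𝔑`, so it induces local ring maps
`φ : A_𝔫 → A[X]_𝔑` and `ψ : A[X]_𝔑 → A_𝔫` with `ψ ∘ φ = id` (`Localization.localRingHom`). For a system of parameters `s` of `A_𝔫`,
`(φ s, X − 1)` generates an ideal with maximal radical in `A[X]_𝔑`, hence (dimension hypothesis + clause upstairs) is weakly regular;
its prefix `φ s` is weakly regular and descends along the retraction (`RetractRegular.stub_retractRegular`, p133804). If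
`y^q ∈ (s)^[q]` in `A_𝔫` then `φ(y)^q ∈ (φ s, X−1)^[q]`, so `φ y ∈ (φ s, X − 1)` upstairs, and applying `ψ` (which kills `X − 1`) gives
`y ∈ (s)`. No flatness is used. [folklore]
-/

set_option linter.dupNamespace false

noncomputable section

open Polynomial IsLocalRing

namespace Summit.ResolutionOfSingularities.ResolutionOfSingularities.Theorems.FInjectiveMacaulayfication.LaurentDescent

variable {A : Type} [CommRing A]

/-- `𝔫·A[X] + (X − 1)` is the preimage of `𝔫` under evaluation at `1`. [folklore] -/
theorem comap_evalRingHom_one (𝔫 : Ideal A) :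
    𝔫.comap (Polynomial.evalRingHom (1 : A)) = 𝔫.map (Polynomial.C : A →+* A[X]) ⊔ Ideal.span {(X - 1 : A[X])} := by
  apply le_antisymm
  · intro g hg
    rw [Ideal.mem_comap, Polynomial.coe_evalRingHom] at hg
    obtain ⟨h, hh⟩ : (X - C (1 : A)) ∣ g - C (g.eval 1) := Polynomial.X_sub_C_dvd_sub_C_eval
    rw [map_one] at hh
    have e : g = C (g.eval 1) + (X - 1) * h := sub_eq_iff_eq_add'.mp hh
    rw [e]
    exact Ideal.add_mem _ (Ideal.mem_sup_left (Ideal.mem_map_of_mem _ hg))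
      (Ideal.mem_sup_right (Ideal.mul_mem_right _ _ (Ideal.subset_span rfl)))
  · refine sup_le ?_ ?_
    · rw [Ideal.map_le_iff_le_comap]
      intro a ha
      simpa [Ideal.mem_comap] using ha
    · rw [Ideal.span_le, Set.singleton_subset_iff, SetLike.mem_coe, Ideal.mem_comap]
      simp

/-- `𝔫` is the preimage of `𝔫·A[X] + (X − 1)` under `C`. [folklore] -/
theorem comap_C_eq (𝔫 : Ideal A) (𝔑 : Ideal A[X])
    (h𝔑 : 𝔑 = 𝔫.map (Polynomial.C : A →+* A[X]) ⊔ Ideal.span {(X - 1 : A[X])}) :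
    𝔫 = 𝔑.comap (Polynomial.C : A →+* A[X]) := by
  have h1 : 𝔑 = 𝔫.comap (Polynomial.evalRingHom (1 : A)) := by rw [h𝔑, comap_evalRingHom_one]
  rw [h1, Ideal.comap_comap]
  have : (Polynomial.evalRingHom (1 : A)).comp (Polynomial.C : A →+* A[X]) = RingHom.id A := by
    ext a; simp
  rw [this, Ideal.comap_id]

/-- **LAURENT DESCENT OF THE CLAUSE** (see the module docstring): `A` of characteristic `p`, `𝔫` maximal, `𝔑 = 𝔫·A[X] + (X−1)`; if
`A[X]_𝔑` has dimension `dim A_𝔫 + 1` and satisfies the clause (every system of parameters weakly regular, every parameter ideal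
Frobenius closed), then so does `A_𝔫`. [folklore] -/
theorem laurentDescent (p : ℕ) [Fact p.Prime] (A : Type) [CommRing A] (𝔫 : Ideal A) [𝔫.IsMaximal]
    (𝔑 : Ideal A[X]) [𝔑.IsPrime]
    (h𝔑 : 𝔑 = 𝔫.map (Polynomial.C : A →+* A[X]) ⊔ Ideal.span {(X - 1 : A[X])})
    (hdim : ∀ d : ℕ, ringKrullDim (Localization.AtPrime 𝔫) = d →
      ringKrullDim (Localization.AtPrime 𝔑) = ((d + 1 : ℕ) : WithBot ℕ∞))
    (hD : ∀ d : ℕ, ringKrullDim (Localization.AtPrime 𝔑) = d → ∀ s : Fin d → Localization.AtPrime 𝔑,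
      (Ideal.span (Set.range s)).radical.IsMaximal →
        RingTheory.Sequence.IsWeaklyRegular (Localization.AtPrime 𝔑) (List.ofFn s) ∧
        ∀ y : Localization.AtPrime 𝔑, (∃ e : ℕ, y ^ p ^ e ∈ Ideal.span
          ((fun z : Localization.AtPrime 𝔑 => z ^ p ^ e) ''
            (Ideal.span (Set.range s) : Set (Localization.AtPrime 𝔑)))) → y ∈ Ideal.span (Set.range s)) :
    ∀ d : ℕ, ringKrullDim (Localization.AtPrime 𝔫) = d → ∀ s : Fin d → Localization.AtPrime 𝔫,
      (Ideal.span (Set.range s)).radical.IsMaximal →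
        RingTheory.Sequence.IsWeaklyRegular (Localization.AtPrime 𝔫) (List.ofFn s) ∧
        ∀ y : Localization.AtPrime 𝔫, (∃ e : ℕ, y ^ p ^ e ∈ Ideal.span
          ((fun z : Localization.AtPrime 𝔫 => z ^ p ^ e) ''
            (Ideal.span (Set.range s) : Set (Localization.AtPrime 𝔫)))) → y ∈ Ideal.span (Set.range s) := by
  intro d hd s hs
  -- the two local ring maps: `φ` induced by `C`, `ψ` induced by evaluation at `1`; `ψ ∘ φ = id`
  have hC : 𝔫 = 𝔑.comap (Polynomial.C : A →+* A[X]) := comap_C_eq 𝔫 𝔑 h𝔑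
  have hr : 𝔑 = 𝔫.comap (Polynomial.evalRingHom (1 : A)) := by rw [h𝔑, comap_evalRingHom_one]
  obtain ⟨φ, hφ⟩ : ∃ φ : Localization.AtPrime 𝔫 →+* Localization.AtPrime 𝔑,
      φ = Localization.localRingHom 𝔫 𝔑 (Polynomial.C : A →+* A[X]) hC := ⟨_, rfl⟩
  obtain ⟨ψ, hψ⟩ : ∃ ψ : Localization.AtPrime 𝔑 →+* Localization.AtPrime 𝔫,
      ψ = Localization.localRingHom 𝔑 𝔫 (Polynomial.evalRingHom (1 : A)) hr := ⟨_, rfl⟩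
  have hφa : ∀ a : A, φ (algebraMap A _ a) = algebraMap A[X] _ (C a) := fun a => by
    rw [hφ, Localization.localRingHom_to_map]
  have hψa : ∀ g : A[X], ψ (algebraMap A[X] _ g) = algebraMap A _ (g.eval 1) := fun g => by
    rw [hψ, Localization.localRingHom_to_map, Polynomial.coe_evalRingHom]
  haveI : IsLocalHom φ := by rw [hφ]; infer_instance
  have hψφ' : ψ.comp φ = RingHom.id _ := by
    refine IsLocalization.ringHom_ext 𝔫.primeCompl ?_
    ext a
    simp only [RingHom.comp_apply, RingHom.id_apply, hφa, hψa, Polynomial.eval_C]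
  have hψφ : ∀ x, ψ (φ x) = x := fun x => by
    simpa using congrArg (fun g => g x) hψφ'
  -- the retraction as an `A_𝔫`-linear map for the algebra structure given by `φ`
  letI : Algebra (Localization.AtPrime 𝔫) (Localization.AtPrime 𝔑) := φ.toAlgebra
  have halg : ∀ x, algebraMap (Localization.AtPrime 𝔫) (Localization.AtPrime 𝔑) x = φ x := fun _ => rfl
  let ρ : Localization.AtPrime 𝔑 →ₗ[Localization.AtPrime 𝔫] Localization.AtPrime 𝔫 :=
    { toFun := ψ
      map_add' := fun x y => map_add ψ x y
      map_smul' := fun a x => by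
        rw [Algebra.smul_def, halg, map_mul, hψφ, smul_eq_mul, RingHom.id_apply] }
  have hρ1 : ρ 1 = 1 := map_one ψ
  -- the extended sequence `s' = (φ s, X − 1)` upstairs
  obtain ⟨t, ht⟩ : ∃ t : Localization.AtPrime 𝔑, t = algebraMap A[X] (Localization.AtPrime 𝔑) (X - 1) := ⟨_, rfl⟩
  obtain ⟨s', hs'⟩ : ∃ s' : Fin (d + 1) → Localization.AtPrime 𝔑, s' = Fin.snoc (fun i => φ (s i)) t := ⟨_, rfl⟩
  have hs'c : ∀ j : Fin d, s' (Fin.castSucc j) = φ (s j) := fun j => by rw [hs', Fin.snoc_castSucc]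
  have hs'l : s' (Fin.last d) = t := by rw [hs', Fin.snoc_last]
  have hψt : ψ t = 0 := by rw [ht, hψa]; simp
  have hlist : List.ofFn s' = List.ofFn (fun i => φ (s i)) ++ [t] := by
    rw [List.ofFn_succ', List.concat_eq_append]
    simp only [hs'c, hs'l]
  -- `φ` maps `(s)` into `(s')`
  have hmapφ : (Ideal.span (Set.range s)).map φ ≤ Ideal.span (Set.range s') := by
    rw [Ideal.map_span, Ideal.span_le]
    rintro _ ⟨_, ⟨j, rfl⟩, rfl⟩
    rw [← hs'c]
    exact Ideal.subset_span ⟨_, rfl⟩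
  -- the radical of `(s')` is the maximal ideal
  have hmaxA : (Ideal.span (Set.range s)).radical = maximalIdeal (Localization.AtPrime 𝔫) :=
    IsLocalRing.eq_maximalIdeal hs
  have hsub : Ideal.span (Set.range s') ≤ maximalIdeal (Localization.AtPrime 𝔑) := by
    rw [Ideal.span_le]
    rintro _ ⟨i, rfl⟩
    refine Fin.lastCases ?_ (fun j => ?_) i
    · rw [SetLike.mem_coe, hs'l, ht, IsLocalization.AtPrime.to_map_mem_maximal_iff (Localization.AtPrime 𝔑) 𝔑, h𝔑]
      exact Ideal.mem_sup_right (Ideal.subset_span rfl)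
    · rw [SetLike.mem_coe, hs'c]
      have hj : s j ∈ maximalIdeal (Localization.AtPrime 𝔫) := by
        rw [← hmaxA]; exact Ideal.le_radical (Ideal.subset_span ⟨j, rfl⟩)
      exact map_nonunit φ (s j) hj
  have hsup : maximalIdeal (Localization.AtPrime 𝔑) ≤ (Ideal.span (Set.range s')).radical := by
    rw [← IsLocalization.AtPrime.map_eq_maximalIdeal 𝔑 (Localization.AtPrime 𝔑), Ideal.map_le_iff_le_comap]
    suffices key : Ideal.map (Polynomial.C : A →+* A[X]) 𝔫 ⊔ Ideal.span {(X - 1 : A[X])} ≤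
        Ideal.comap (algebraMap A[X] (Localization.AtPrime 𝔑)) (Ideal.span (Set.range s')).radical by
      intro g hg
      rw [h𝔑] at hg
      exact key hg
    refine sup_le ?_ ?_
    · rw [Ideal.map_le_iff_le_comap]
      intro a ha
      rw [Ideal.mem_comap, Ideal.mem_comap, ← hφa]
      have ha' : algebraMap A (Localization.AtPrime 𝔫) a ∈ (Ideal.span (Set.range s)).radical := by
        rw [hmaxA, IsLocalization.AtPrime.to_map_mem_maximal_iff (Localization.AtPrime 𝔫) 𝔫]
        exact ha
      obtain ⟨m, hm⟩ := ha'
      refine ⟨m, ?_⟩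
      rw [← map_pow]
      exact hmapφ (Ideal.mem_map_of_mem φ hm)
    · rw [Ideal.span_le, Set.singleton_subset_iff, SetLike.mem_coe, Ideal.mem_comap, ← ht, ← hs'l]
      exact Ideal.le_radical (Ideal.subset_span ⟨_, rfl⟩)
  have hradeq : (Ideal.span (Set.range s')).radical = maximalIdeal (Localization.AtPrime 𝔑) :=
    le_antisymm ((Ideal.IsPrime.radical_le_iff inferInstance).mpr hsub) hsup
  have hrad : (Ideal.span (Set.range s')).radical.IsMaximal := by
    rw [hradeq]; exact IsLocalRing.maximalIdeal.isMaximal _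
  -- the clause upstairs at `s'`
  obtain ⟨hreg', hF'⟩ := hD (d + 1) (hdim d hd) s' hrad
  refine ⟨?_, ?_⟩
  · -- CM half: prefix of a weakly regular sequence, descended along the retraction
    rw [hlist, RingTheory.Sequence.isWeaklyRegular_append_iff] at hreg'
    have h1 : RingTheory.Sequence.IsWeaklyRegular (Localization.AtPrime 𝔑)
        ((List.ofFn s).map (algebraMap (Localization.AtPrime 𝔫) (Localization.AtPrime 𝔑))) := by
      rw [List.map_ofFn]
      exact hreg'.1
    exact RetractRegular.stub_retractRegular _ _ ρ hρ1 (List.ofFn s) h1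
  · -- Frobenius half
    rintro y ⟨e, hy⟩
    have h1 : φ y ^ p ^ e ∈ Ideal.span ((fun z : Localization.AtPrime 𝔑 => z ^ p ^ e) ''
        (Ideal.span (Set.range s') : Set (Localization.AtPrime 𝔑))) := by
      have h := Ideal.mem_map_of_mem φ hy
      rw [map_pow, Ideal.map_span] at h
      refine Ideal.span_mono ?_ h
      rintro _ ⟨_, ⟨z, hz, rfl⟩, rfl⟩
      refine ⟨φ z, hmapφ (Ideal.mem_map_of_mem φ hz), ?_⟩
      simp only [map_pow]
    have h2 : φ y ∈ Ideal.span (Set.range s') := hF' (φ y) ⟨e, h1⟩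
    have h3 : y ∈ (Ideal.span (Set.range s')).map ψ := by
      rw [← hψφ y]; exact Ideal.mem_map_of_mem ψ h2
    rw [Ideal.map_span] at h3
    refine (Ideal.span_le.mpr ?_) h3
    rintro _ ⟨_, ⟨i, rfl⟩, rfl⟩
    refine Fin.lastCases ?_ (fun j => ?_) i
    · rw [SetLike.mem_coe, hs'l, hψt]; exact Ideal.zero_mem _
    · rw [SetLike.mem_coe, hs'c, hψφ]; exact Ideal.subset_span ⟨j, rfl⟩

end Summit.ResolutionOfSingularities.ResolutionOfSingularities.Theorems.FInjectiveMacaulayfication.LaurentDescent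

end
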